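import Literature.AlgebraicGeometry.Frobenioids.FiberProductsMorphisms
import Literature.AlgebraicGeometry.Frobenioids.FiberProductsLifts
import Literature.AlgebraicGeometry.Frobenioids.RationalFunctionMonoidStrEquivalence
import HarnessLib

/-!
# Frobenioids I, Proposition 1.6 (Categorical Fiber Products) and Proposition 4.4: the rational functions
# `O^×(A′^birat)` of `C′ = C ×_D D′` are those of the projection `A`, and the rational function monoid of `C′`
# is the restriction of that of `C`

Mochizuki, *The geometry of Frobenioids I: the general theory*, Kyushu J. Math. **62** (2008) 293–400, §1,
Prop. 1.6, kurims text pp. 27–28 [cite: MochizukiFrdI2008, Prop. 1.6 p.27]: "(iii) A morphism of `C′` is a(n)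
[…] co-angular morphism […] if and only if its projection to `C` is. (iv) A base-isomorphism of `C′` is a
morphism of Frobenius type (respectively, pre-step; step) if and only if its projection to `C` is. Moreover, the
projection functor `C′ → C` determines a bijection of monoids `O^▷(A′) ⥲ O^▷(A)`, for every `A′ ∈ Ob(C′)` that
projects to `A ∈ Ob(C)`."; §4, Prop. 4.4 (ii)/(iv) p. 83 (the rational function monoid `A ↦ O^×(A^birat)`,
base-identity endomorphisms of `A^birat` as fractions of base-equivalent co-angular pre-steps) and Thm. 5.2 (ii)
p. 101 ("the *model Frobenioid* defined by the divisor monoid `Φ` and the rational function monoid `B`"; the natural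
isomorphism "`O^×(−)`" ≅ `B` compatible with `Div_B` is typed by abc-iut-L1-t2 as `PreFrobenioid.RationalFunctionMonoidStr`).

WHAT THIS FILE PROVES (our words; print states Prop. 1.6 for `O^▷`, not for `O^×(−^birat)` — the statements
below are the evident birational companions, obtained from Prop. 1.6 (iii)(iv) exactly as typed by the STEP-0
crew in `FiberProductsMorphisms.lean` / `FiberProductsLifts.lean`).  For a Frobenioid `F : C → F_Φ`, a functor
`G : D′ → D` and the fibre product structure `F′ := fiberProductFunctor F G : C′ = C ×_D D′ → F_{Φ|_{D′}}`
(assumed to be a Frobenioid, `hF′` — abc-iut-found's `isFrobenioid_fiberProduct` under the printed hypotheses):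
* `FiberProduct.isCoAngularPreStep_fst` / `isCoAngularPreStep_of_fst` — co-angular pre-steps of `C′` are exactly
  the arrows with co-angular pre-step projection and invertible `D′`-component (Prop. 1.6 (iii)(iv));
* `FiberProduct.exists_mulEquiv_biratUnits_fst` — for `X = (A, A′_{D′}, α) ∈ Ob(C′)` the projection induces a group
  isomorphism `O^×(X^birat) ⥲ O^×(A^birat)` on abc-iut-L1's explicit `BiratUnits` (a fraction `(δ, ν)` of `C′`
  projects to the fraction `(δ_C, ν_C)`; injective/surjective by lifting refinements / fractions of `C` to `C′`
  with identity `D′`-components, `liftSrcHom`, `liftDom`), characterised by its value on fractions, carrying the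
  divisor map of `C′` to `(α⁻¹)^*` of that of `C` (`invDiv_eq`);
* `FiberProduct.intertwines_of_intertwines_fst` — "`ψ ∘ u = v ∘ ψ` in `C′^birat`" is REFLECTED by the projection
  (lift the witnessing square, `Intertwines.exists_data` of `RationalFunctionMonoidStrEquivalence.lean`);
* **`RationalFunctionMonoidStr.nonempty_fiberProduct`** — if `(B, Div_B)` is the rational function monoid of `F`
  then `(G^op ⋙ B, Div_B|_{D′})` is the rational function monoid of `F′` (objectwise through `B(α)`, the divisor
  compatibility by naturality of `Div_B`, naturality along linear morphisms of `C′` by the reflected relation).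
Consumer: [IUTchI] Ex 5.1 (vi) for `†ℱ^⊚ = †ℱ^⊛|_{†𝒟^⊚}` (`Literature/IUT/HodgeTheaters/`, abc-iut-w4-d050).
Proof-only (0 `def`s); no statement of the paper is restated or strengthened; nothing here is specific to the
abc programme.
-/

namespace Literature.AlgebraicGeometry.Frobenioids

open CategoryTheory Opposite

universe w v v' v'' u u' u''

namespace PreFrobenioid

variable {D : Type u} [Category.{v} D] {D' : Type u'} [Category.{v'} D']
  {Φ : Dᵒᵖ ⥤ CommMonCat.{w}} {C : Type u''} [Category.{v''} C]
  {F : C ⥤ ElemFrobenioid Φ} {G : D' ⥤ D}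

namespace FiberProduct

/-! ### Co-angular pre-steps of `C′` (Prop. 1.6 (iii)(iv)) -/

/-- The projection of a co-angular pre-step of `C′` is a co-angular pre-step of `C` (Prop. 1.6 (iii) co-angular,
(iv) pre-step). [cite: MochizukiFrdI2008, Prop. 1.6 p.27] -/
theorem isCoAngularPreStep_fst (hF : IsFrobenioid F) {X Y : FiberProduct F G} {f : X ⟶ Y}
    (hf : IsCoAngularPreStep (fiberProductFunctor F G) f) : IsCoAngularPreStep F f.fst :=
  ⟨(isCoAngular_fiberProduct_iff hF f).mp hf.1, (isPreStep_fiberProduct_iff f hf.2.2).mp hf.2⟩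

/-- The `D′`-component of a co-angular pre-step of `C′` is an isomorphism (`Base′ = snd`).
[cite: MochizukiFrdI2008, Prop. 1.6 p.27] -/
theorem isIso_snd_of_isCoAngularPreStep {X Y : FiberProduct F G} {f : X ⟶ Y}
    (hf : IsCoAngularPreStep (fiberProductFunctor F G) f) : IsIso f.snd :=
  hf.2.2

/-- An arrow of `C′` with invertible `D′`-component whose projection is a co-angular pre-step is a co-angular
pre-step (Prop. 1.6 (iii)(iv), converse direction). [cite: MochizukiFrdI2008, Prop. 1.6 p.27] -/
theorem isCoAngularPreStep_of_fst {X Y : FiberProduct F G} (f : X ⟶ Y) [IsIso f.snd]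
    (hf : IsCoAngularPreStep F f.fst) : IsCoAngularPreStep (fiberProductFunctor F G) f :=
  ⟨isCoAngular_fiberProduct_of_fst f hf.1, (isPreStep_fiberProduct_iff f ‹IsIso f.snd›).mpr hf.2⟩

/-- The two arrows of a fraction of `C′` have the same `D′`-component. [cite: MochizukiFrdI2008, Prop. 4.4(iv) p.83] -/
theorem ratFrac_den_snd {X : FiberProduct F G} (p : RatFrac (fiberProductFunctor F G) X) :
    p.den.snd = p.num.snd :=
  p.baseEq

/-! ### Projection of fractions and of the refinement relation -/

/-- Projection of refinement data: if `(δ, ν) ∼ (δ', ν')` in `C′` then `(δ_C, ν_C) ∼ (δ'_C, ν'_C)` in `C`.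
[cite: MochizukiFrdI2008, Prop. 4.4 p.82] -/
theorem rel_fst (hF : IsFrobenioid F) {X : FiberProduct F G} {p q : RatFrac (fiberProductFunctor F G) X}
    (h : RatFrac.Rel p q) :
    RatFrac.Rel
      (⟨p.src.fst, p.den.fst, p.num.fst, isCoAngularPreStep_fst hF p.den_mem, isCoAngularPreStep_fst hF p.num_mem,
        base_fst_eq_of_snd_eq p.baseEq⟩ : RatFrac F X.fst)
      ⟨q.src.fst, q.den.fst, q.num.fst, isCoAngularPreStep_fst hF q.den_mem, isCoAngularPreStep_fst hF q.num_mem,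
        base_fst_eq_of_snd_eq q.baseEq⟩ := by
  obtain ⟨E, ε, ε', hε, hε', h₁, h₂⟩ := h
  exact ⟨E.fst, ε.fst, ε'.fst, isCoAngularPreStep_fst hF hε, isCoAngularPreStep_fst hF hε',
    congrArg CFP.Hom.fst h₁, congrArg CFP.Hom.fst h₂⟩

/-- Lifting refinement data: if the projections of two fractions of `C′` at `X` are refinement-related in `C`,
the fractions are refinement-related in `C′` (lift the refining pre-steps with identity `D′`-components,
`liftSrcHom` / `liftDom`). [cite: MochizukiFrdI2008, Prop. 4.4 p.82] -/
theorem rel_of_rel_fst (hF : IsFrobenioid F) {X : FiberProduct F G} {p q : RatFrac (fiberProductFunctor F G) X}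
    (h : RatFrac.Rel
      (⟨p.src.fst, p.den.fst, p.num.fst, isCoAngularPreStep_fst hF p.den_mem, isCoAngularPreStep_fst hF p.num_mem,
        base_fst_eq_of_snd_eq p.baseEq⟩ : RatFrac F X.fst)
      ⟨q.src.fst, q.den.fst, q.num.fst, isCoAngularPreStep_fst hF q.den_mem, isCoAngularPreStep_fst hF q.num_mem,
        base_fst_eq_of_snd_eq q.baseEq⟩) :
    RatFrac.Rel p q := by
  obtain ⟨E, ε, ε', hε, hε', h₁, h₂⟩ := h
  change E ⟶ p.src.fst at ε
  change E ⟶ q.src.fst at ε'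
  change ε ≫ p.den.fst = ε' ≫ q.den.fst at h₁
  change ε ≫ p.num.fst = ε' ≫ q.num.fst at h₂
  haveI : IsIso (Base F ε) := hε.2.2
  haveI : IsIso q.den.snd := isIso_snd_of_isCoAngularPreStep q.den_mem
  -- `ε↑ = (ε, id)`, `ε'↑` the `liftDom` of `ε'` against `q.den`
  let εu : liftSrc p.src ε hε.2.2 ⟶ p.src := liftSrcHom p.src ε hε.2.2
  let ε'u : liftSrc p.src ε hε.2.2 ⟶ q.src := liftDom (εu ≫ p.den) q.den ε' h₁.symm
  have hεu : IsCoAngularPreStep (fiberProductFunctor F G) εu := by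
    haveI : IsIso εu.snd := by change IsIso (𝟙 p.src.snd); infer_instance
    exact isCoAngularPreStep_of_fst εu hε
  haveI : IsIso p.den.snd := isIso_snd_of_isCoAngularPreStep p.den_mem
  have hε'u : IsCoAngularPreStep (fiberProductFunctor F G) ε'u := by
    haveI : IsIso ε'u.snd := by
      change IsIso ((𝟙 _ ≫ p.den.snd) ≫ inv q.den.snd); infer_instance
    exact isCoAngularPreStep_of_fst ε'u hε'
  have hp : p.den.snd = p.num.snd := ratFrac_den_snd p
  have hq : q.den.snd = q.num.snd := ratFrac_den_snd q
  refine ⟨_, εu, ε'u, hεu, hε'u, (liftDom_comp (εu ≫ p.den) q.den ε' h₁.symm).symm, ?_⟩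
  apply CFP.hom_ext
  · exact h₂
  · change 𝟙 _ ≫ p.num.snd = ((𝟙 _ ≫ p.den.snd) ≫ inv q.den.snd) ≫ q.num.snd
    rw [← hq, Category.assoc, IsIso.inv_hom_id, Category.comp_id, hp]

/-- Lifting a fraction of `C` at `A = X_C` to a fraction of `C′` at `X` with identity `D′`-components:
`(α, φ) ↦ ((α, id), (φ, id))` out of `(Y, X_{D′}, e_X ∘ α_D)`. [cite: MochizukiFrdI2008, Prop. 4.4(iv) p.83] -/
theorem exists_ratFrac_fst_eq (hF : IsFrobenioid F) (X : FiberProduct F G) (p : RatFrac F X.fst) :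
    ∃ p' : RatFrac (fiberProductFunctor F G) X,
      (⟨p'.src.fst, p'.den.fst, p'.num.fst, isCoAngularPreStep_fst hF p'.den_mem, isCoAngularPreStep_fst hF p'.num_mem,
        base_fst_eq_of_snd_eq p'.baseEq⟩ : RatFrac F X.fst) = p := by
  haveI : IsIso (Base F p.den) := p.den_mem.2.2
  let αu : liftSrc X p.den p.den_mem.2.2 ⟶ X := liftSrcHom X p.den p.den_mem.2.2
  have hb : Base F p.den = Base F p.num := p.baseEq
  let φu : liftSrc X p.den p.den_mem.2.2 ⟶ X := ⟨p.num, 𝟙 X.snd, by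
    change Base F p.num ≫ X.e.hom = (Base F p.den ≫ X.e.hom) ≫ G.map (𝟙 X.snd)
    rw [G.map_id, Category.comp_id, hb]⟩
  haveI : IsIso αu.snd := by change IsIso (𝟙 X.snd); infer_instance
  haveI : IsIso φu.snd := by change IsIso (𝟙 X.snd); infer_instance
  exact ⟨⟨_, αu, φu, isCoAngularPreStep_of_fst αu p.den_mem, isCoAngularPreStep_of_fst φu p.num_mem, rfl⟩, rfl⟩

/-! ### The projection isomorphism `O^×(X^birat) ⥲ O^×(A^birat)` and its divisor compatibility -/

/-- The divisor of a fraction of `C′` at `X = (A, A′, α)` is `(α⁻¹)^*` of the divisor of its projection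
(`invDiv_eq`). [cite: MochizukiFrdI2008, Prop. 4.4(i) p.84] -/
theorem div_eq_pullGp_div_fst (hF : IsFrobenioid F) {X : FiberProduct F G}
    (p : RatFrac (fiberProductFunctor F G) X) :
    RatFrac.div p = pullGp Φ X.e.inv (RatFrac.div
      (⟨p.src.fst, p.den.fst, p.num.fst, isCoAngularPreStep_fst hF p.den_mem, isCoAngularPreStep_fst hF p.num_mem,
        base_fst_eq_of_snd_eq p.baseEq⟩ : RatFrac F X.fst)) := by
  change Algebra.GrothendieckGroup.of (invDiv (fiberProductFunctor F G) p.num p.num_mem.2.2) /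
      Algebra.GrothendieckGroup.of (invDiv (fiberProductFunctor F G) p.den p.den_mem.2.2) =
    pullGp Φ X.e.inv (Algebra.GrothendieckGroup.of (invDiv F p.num.fst _) /
      Algebra.GrothendieckGroup.of (invDiv F p.den.fst _))
  rw [map_div, pullGp_of, pullGp_of, invDiv_eq p.num, invDiv_eq p.den]
  rfl

/-- **The projection `C′ → C` induces `O^×(X^birat) ⥲ O^×(A^birat)`** for `X = (A, A′, α) ∈ Ob(C′)`: a group
isomorphism on the explicit rational functions of Prop. 4.4 (iv), `[(δ, ν)] ↦ [(δ_C, ν_C)]`, carrying the divisor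
map of `C′` ([FrdI] Prop 4.4 (iii)) to `(α⁻¹)^*` of the divisor map of `C`.
[cite: MochizukiFrdI2008, Prop. 1.6 p.27] -/
theorem exists_mulEquiv_biratUnits_fst (hF : IsFrobenioid F) (hF' : IsFrobenioid (fiberProductFunctor F G))
    (X : FiberProduct F G) :
    ∃ π : BiratUnits (fiberProductFunctor F G) hF' X ≃* BiratUnits F hF X.fst,
      (∀ p : RatFrac (fiberProductFunctor F G) X, π (BiratUnits.mk hF' p) =
        BiratUnits.mk hF ⟨p.src.fst, p.den.fst, p.num.fst, isCoAngularPreStep_fst hF p.den_mem,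
          isCoAngularPreStep_fst hF p.num_mem, base_fst_eq_of_snd_eq p.baseEq⟩) ∧
      ∀ x, BiratUnits.divHom hF' X x = pullGp Φ X.e.inv (BiratUnits.divHom hF X.fst (π x)) := by
  -- the projection on fractions
  let pr : RatFrac (fiberProductFunctor F G) X → RatFrac F X.fst := fun p =>
    ⟨p.src.fst, p.den.fst, p.num.fst, isCoAngularPreStep_fst hF p.den_mem, isCoAngularPreStep_fst hF p.num_mem,
      base_fst_eq_of_snd_eq p.baseEq⟩
  let f : BiratUnits (fiberProductFunctor F G) hF' X → BiratUnits F hF X.fst :=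
    Quotient.lift (s := RatFrac.setoid (fiberProductFunctor F G) hF' X) (fun p => BiratUnits.mk hF (pr p))
      fun _ _ h => BiratUnits.sound (rel_fst hF h)
  have hf : ∀ p, f (BiratUnits.mk hF' p) = BiratUnits.mk hF (pr p) := fun _ => rfl
  have hmul : ∀ x y, f (x * y) = f x * f y := by
    intro x y
    obtain ⟨p, rfl⟩ := BiratUnits.mk_surjective x
    obtain ⟨q, rfl⟩ := BiratUnits.mk_surjective y
    let R := RatFrac.someRefinement hF' q p
    let R' : RatFrac.Refinement (pr q) (pr p) :=
      ⟨R.apex.fst, R.left.fst, R.right.fst, isCoAngularPreStep_fst hF R.left_mem, isCoAngularPreStep_fst hF R.right_mem,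
        congrArg CFP.Hom.fst R.w⟩
    rw [BiratUnits.mk_mul_mk_eq p q R, hf, hf, hf, BiratUnits.mk_mul_mk_eq (pr p) (pr q) R']
    rfl
  have hone : f 1 = 1 := by
    rw [BiratUnits.one_def, hf, BiratUnits.one_def]
    rfl
  let fh : BiratUnits (fiberProductFunctor F G) hF' X →* BiratUnits F hF X.fst :=
    { toFun := f, map_one' := hone, map_mul' := hmul }
  have hinj : Function.Injective fh := by
    intro x y hxy
    obtain ⟨p, rfl⟩ := BiratUnits.mk_surjective x
    obtain ⟨q, rfl⟩ := BiratUnits.mk_surjective y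
    change f (BiratUnits.mk hF' p) = f (BiratUnits.mk hF' q) at hxy
    rw [hf, hf, BiratUnits.mk_eq_mk_iff] at hxy
    exact BiratUnits.sound (rel_of_rel_fst hF hxy)
  have hsurj : Function.Surjective fh := by
    intro y
    obtain ⟨p, rfl⟩ := BiratUnits.mk_surjective y
    obtain ⟨p', hp'⟩ := exists_ratFrac_fst_eq hF X p
    exact ⟨BiratUnits.mk hF' p', by change f (BiratUnits.mk hF' p') = _; rw [hf]; exact congrArg _ hp'⟩
  refine ⟨MulEquiv.ofBijective fh ⟨hinj, hsurj⟩, fun p => hf p, fun x => ?_⟩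
  obtain ⟨p, rfl⟩ := BiratUnits.mk_surjective x
  change RatFrac.div p = pullGp Φ X.e.inv (BiratUnits.divHom hF X.fst (f (BiratUnits.mk hF' p)))
  rw [hf, BiratUnits.divHom_mk]
  exact div_eq_pullGp_div_fst hF p

/-! ### "`ψ ∘ u = v ∘ ψ` in `C′^birat`" is reflected by the projection -/

/-- If the projections of `u ∈ O^×(X^birat)`, `v ∈ O^×(X'^birat)` are intertwined by `ψ_C` in `C^birat`, then
`u`, `v` are intertwined by `ψ` in `C′^birat`: lift the witnessing square (`Intertwines.exists_data`,
`liftSrcHom`, `liftDom`). [cite: MochizukiFrdI2008, Prop. 2.2(ii) p.45] -/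
theorem intertwines_of_intertwines_fst (hF : IsFrobenioid F) (hF' : IsFrobenioid (fiberProductFunctor F G))
    {X X' : FiberProduct F G} (ψ : X ⟶ X') (p : RatFrac (fiberProductFunctor F G) X)
    (q : RatFrac (fiberProductFunctor F G) X')
    (h : BiratUnits.Intertwines hF ψ.fst
      (BiratUnits.mk hF ⟨p.src.fst, p.den.fst, p.num.fst, isCoAngularPreStep_fst hF p.den_mem,
        isCoAngularPreStep_fst hF p.num_mem, base_fst_eq_of_snd_eq p.baseEq⟩)
      (BiratUnits.mk hF ⟨q.src.fst, q.den.fst, q.num.fst, isCoAngularPreStep_fst hF q.den_mem,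
        isCoAngularPreStep_fst hF q.num_mem, base_fst_eq_of_snd_eq q.baseEq⟩)) :
    BiratUnits.Intertwines hF' ψ (BiratUnits.mk hF' p) (BiratUnits.mk hF' q) := by
  obtain ⟨E, κ, l, hκ, h₁, h₂⟩ := BiratUnits.Intertwines.exists_data hF h _ _ rfl rfl
  change E ⟶ p.src.fst at κ
  change E ⟶ q.src.fst at l
  change l ≫ q.den.fst = κ ≫ p.den.fst ≫ ψ.fst at h₁
  change l ≫ q.num.fst = κ ≫ p.num.fst ≫ ψ.fst at h₂
  haveI : IsIso (Base F κ) := hκ.2.2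
  haveI : IsIso q.den.snd := isIso_snd_of_isCoAngularPreStep q.den_mem
  let κu : liftSrc p.src κ hκ.2.2 ⟶ p.src := liftSrcHom p.src κ hκ.2.2
  let lu : liftSrc p.src κ hκ.2.2 ⟶ q.src := liftDom (κu ≫ p.den ≫ ψ) q.den l h₁
  have hκu : IsCoAngularPreStep (fiberProductFunctor F G) κu := by
    haveI : IsIso κu.snd := by change IsIso (𝟙 p.src.snd); infer_instance
    exact isCoAngularPreStep_of_fst κu hκ
  have hp : p.den.snd = p.num.snd := ratFrac_den_snd p
  have hq : q.den.snd = q.num.snd := ratFrac_den_snd q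
  refine ⟨p, q, _, κu, lu, rfl, rfl, hκu, liftDom_comp (κu ≫ p.den ≫ ψ) q.den l h₁, ?_⟩
  apply CFP.hom_ext
  · exact h₂
  · change ((𝟙 _ ≫ p.den.snd ≫ ψ.snd) ≫ inv q.den.snd) ≫ q.num.snd = 𝟙 _ ≫ p.num.snd ≫ ψ.snd
    rw [← hq, Category.assoc, IsIso.inv_hom_id, Category.comp_id, hp]

end FiberProduct

/-! ### The rational function monoid of `C′` is the restriction of that of `C` -/

/-- Pulling back along `α ∘ α⁻¹` is the identity on `Φ^gp`. [cite: MochizukiFrdI2008, Def. 1.1(ii) p.19] -/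
theorem pullGp_inv_hom_apply {X Y : D} (e : X ≅ Y) (c : Algebra.GrothendieckGroup (Φ.obj (op Y))) :
    pullGp Φ e.inv (pullGp Φ e.hom c) = c := by
  rw [← pullGp_comp, e.inv_hom_id, pullGp_id]

/-- **The rational function monoid of `C′ = C ×_D D′` is `(B|_{D′}, Div_B|_{D′})`** whenever `(B, Div_B)` is the
rational function monoid of `C` (Prop. 4.4 (ii), in abc-iut-L1-t2's packaging `RationalFunctionMonoidStr`):
objectwise `B(G A′) ≅[B(α)] B(A_D) ≅ O^×(A^birat) ≅ O^×(X^birat)` for `X = (A, A′, α)`; compatible with the divisor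
maps (naturality of `Div_B` along `α`); natural along linear morphisms of `C′` (Prop. 2.2 (ii)), the relation
"`ψ ∘ u = v ∘ ψ`" being reflected by the projection. [cite: MochizukiFrdI2008, Prop. 1.6 p.27] -/
theorem RationalFunctionMonoidStr.nonempty_fiberProduct (hF : IsFrobenioid F)
    (hF' : IsFrobenioid (fiberProductFunctor F G)) {B : Dᵒᵖ ⥤ CommMonCat.{w}} {DivB : B ⟶ monoidGp Φ}
    (S : RationalFunctionMonoidStr F hF B DivB) :
    Nonempty (RationalFunctionMonoidStr (fiberProductFunctor F G) hF' (G.op ⋙ B)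
      (Functor.whiskerLeft G.op DivB)) := by
  -- the projection isomorphisms and the transport `B(α)`
  have hπ := FiberProduct.exists_mulEquiv_biratUnits_fst (G := G) hF hF'
  choose π hπmk hπdiv using hπ
  let tB : ∀ X : FiberProduct F G, B.obj (op (G.obj X.snd)) ≃* B.obj (op (baseObj F X.fst)) := fun X =>
    (B.mapIso X.e.op).commMonCatIsoToMulEquiv
  have htB : ∀ (X : FiberProduct F G) (b : B.obj (op (G.obj X.snd))), tB X b = (B.map X.e.hom.op).hom b :=
    fun X b => rfl
  refine ⟨{ iso := fun X => (tB X).trans ((S.iso X.fst).trans (π X).symm)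
            div_iso := fun X b => ?_
            natural := fun X X' ψ hψ b' => ?_ }⟩
  · -- divisor compatibility
    change BiratUnits.divHom hF' X ((π X).symm (S.iso X.fst (tB X b))) = (DivB.app (op (G.obj X.snd))).hom b
    rw [hπdiv, MulEquiv.apply_symm_apply, S.div_iso, htB]
    change pullGp Φ X.e.inv (divB Φ B DivB _ ((B.map X.e.hom.op).hom b)) = divB Φ B DivB _ b
    rw [← pullGp_divB, pullGp_inv_hom_apply]
    rfl
  · -- naturality along a linear `ψ`
    obtain ⟨p, hp⟩ := BiratUnits.mk_surjective
      ((π X).symm (S.iso X.fst (tB X ((B.map (G.map ψ.snd).op).hom b'))))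
    obtain ⟨q, hq⟩ := BiratUnits.mk_surjective ((π X').symm (S.iso X'.fst (tB X' b')))
    change BiratUnits.Intertwines hF' ψ ((π X).symm (S.iso X.fst (tB X ((B.map (G.map ψ.snd).op).hom b'))))
      ((π X').symm (S.iso X'.fst (tB X' b')))
    rw [← hp, ← hq]
    apply FiberProduct.intertwines_of_intertwines_fst hF hF' ψ p q
    rw [← hπmk, ← hπmk, hp, hq, MulEquiv.apply_symm_apply, MulEquiv.apply_symm_apply, htB, htB]
    have key : (B.map X.e.hom.op).hom ((B.map (G.map ψ.snd).op).hom b') =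
        (B.map (Base F ψ.fst).op).hom ((B.map X'.e.hom.op).hom b') := by
      rw [← CommMonCat.comp_apply, ← CommMonCat.comp_apply, ← B.map_comp, ← B.map_comp, ← op_comp, ← op_comp,
        FiberProduct.hom_w ψ]
    rw [key]
    exact S.natural ψ.fst hψ ((B.map X'.e.hom.op).hom b')

end PreFrobenioid

end Literature.AlgebraicGeometry.Frobenioids
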